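import Literature.Analysis.FunctionSpaces.BesovDifference
import Mathlib.MeasureTheory.Function.LpSpace.ContinuousCompMeasurePreserving
import Mathlib.Topology.CompactOpen
import HarnessLib

/-!
# Measurability in time of the Besov sup seminorm of the slices of a space–time field

Analysis/FunctionSpaces support file (theorem-only; serves the time integration of the
coarse-graining estimates in the Drivas–Eyink dissipation bound,
`Literature/Barriers/AnomalousDissipation/OnsagerSingularityLeray`, where products of two
time-dependent Besov seminorms `[f(t)]_{B^σ_{2,∞}} [u(t)]_{B^σ_{2,∞}}` have to be integrated in
time by Cauchy–Schwarz, which requires their measurability in `t`).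

For a field `u : α → G → F` on a parameter (time) space `α` with values in functions on a
locally compact second countable normed additive group `G` carrying a right-invariant Radon
measure `μ`, jointly (a.e. strongly) measurable on `α × G` and with `u t ∈ L^p(μ)` for a.e. `t`
(`1 ≤ p < ∞`), the Nikol'skii–Besov seminorm of the slices,
`t ↦ [u t]_{B^s_{p,∞}} = sup_{h ≠ 0} ‖u t (· + h) - u t‖_{L^p} / ‖h‖^s`
(`Literature.Analysis.FunctionSpaces.eBesovSupSeminorm`), is a.e.-measurable
(`aemeasurable_eBesovSupSeminorm_slice`). The supremum over the uncountable set `{h ≠ 0}` is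
reduced to a countable one (`eBesovSupSeminorm_eq_iSup_seq`) through the **continuity of
translation in `L^p`** (`continuous_eLpNorm_comp_add_sub`, from Mathlib's
`MeasureTheory.Lp.compMeasurePreserving_continuous`), and for each fixed increment `h` the slice
norm `t ↦ ‖U(t, · + h) - U(t, ·)‖_{L^p}` of a strongly measurable representative `U` is
measurable by Tonelli (`measurable_eLpNorm_slice_comp_add_sub`).

## Mathlib search

Mathlib (this pin) has the continuity of `(g, f) ↦ g ∘ f` on `Lp E p ν × C(X, Y)`
(`MeasureTheory.Lp.compMeasurePreserving_continuous`, Kudryashov 2024), measurability of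
parametric lower Lebesgue integrals (`Measurable.lintegral_prod_right'`), countable suprema of
measurable functions (`Measurable.iSup`), dense sequences (`TopologicalSpace.denseSeq`); it has
no Besov/Nikol'skii classes (searched `Besov`, `Nikolskii`, `translation modulus`: none beyond
the tree's `BesovDifference`).

## References

* H. Triebel, *Theory of Function Spaces* (1983), §2.5.12 (the difference characterisation of
  `B^s_{p,∞}`). [Triebel1983]
* W. Rudin, *Real and Complex Analysis*, 3rd ed., Thm. 9.5 (continuity of translation in
  `L^p`, `1 ≤ p < ∞`). [folklore]
-/

open MeasureTheory Set Filter Function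
open _root_.Topology
open scoped ENNReal NNReal

noncomputable section

namespace Literature.Analysis.FunctionSpaces

variable {G : Type*} [NormedAddCommGroup G] [MeasurableSpace G] [BorelSpace G]
  [LocallyCompactSpace G]
  {F : Type*} [NormedAddCommGroup F]
  {μ : Measure G} [μ.IsAddRightInvariant] [IsFiniteMeasureOnCompacts μ] [μ.InnerRegularCompactLTTop]
  {α : Type*} [MeasurableSpace α] {ρ : Measure α}

/-! ## Continuity of translation in `L^p` -/

omit [MeasurableSpace G] [BorelSpace G] [LocallyCompactSpace G] in
/-- The right translations `x ↦ x + h`, as continuous self-maps of `G`, depend continuously on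
`h` for the compact-open topology (Mathlib's `ContinuousMap.continuous_of_continuous_uncurry`). [folklore] -/
theorem continuous_addRight_continuousMap :
    Continuous fun h : G => (⟨fun x => x + h, continuous_id.add continuous_const⟩ : C(G, G)) :=
  ContinuousMap.continuous_of_continuous_uncurry _ (continuous_snd.add continuous_fst)

/-- **Continuity of translation in `L^p`** (Rudin, *Real and Complex Analysis*, Thm. 9.5, on a
locally compact group with a right-invariant Radon measure): for `g ∈ L^p(μ)`, `1 ≤ p < ∞`, the
map `h ↦ ‖g(· + h) - g‖_{L^p(μ)}` is continuous (Mathlib's joint continuity of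
`Lp.compMeasurePreserving`, applied to the continuous family of measure-preserving translations). [folklore] -/
theorem continuous_eLpNorm_comp_add_sub {p : ℝ≥0∞} (hp : 1 ≤ p) (hp' : p ≠ ∞) {g : G → F}
    (hg : MemLp g p μ) :
    Continuous fun h : G => eLpNorm (fun x => g (x + h) - g x) p μ := by
  haveI : Fact (1 ≤ p) := ⟨hp⟩
  set gp : Lp F p μ := hg.toLp g with hgp
  have hmp : ∀ h : G, MeasurePreserving (fun x => x + h) μ μ := fun h =>
    measurePreserving_add_right μ h
  set Φ : G → Lp F p μ := fun h =>
    Lp.compMeasurePreserving (⟨fun x => x + h, continuous_id.add continuous_const⟩ : C(G, G))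
      (hmp h) gp with hΦ
  have hΦc : Continuous Φ :=
    Continuous.compMeasurePreservingLp (μ := μ) (ν := μ) continuous_const
      continuous_addRight_continuousMap hmp hp'
  have heq : ∀ h, eLpNorm (fun x => g (x + h) - g x) p μ = ‖Φ h - gp‖ₑ := by
    intro h
    rw [Lp.enorm_def]
    refine eLpNorm_congr_ae ?_
    have h1 : ⇑(Φ h) =ᵐ[μ] ⇑gp ∘ fun x => x + h := Lp.coeFn_compMeasurePreserving gp (hmp h)
    have h2 : ⇑gp =ᵐ[μ] g := hg.coeFn_toLp
    have h3 : ⇑gp ∘ (fun x => x + h) =ᵐ[μ] g ∘ fun x => x + h :=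
      (hmp h).quasiMeasurePreserving.ae_eq_comp h2
    filter_upwards [Lp.coeFn_sub (Φ h) gp, h1, h2, h3] with x hx hx1 hx2 hx3
    rw [hx, Pi.sub_apply, hx1, hx3, hx2]
    rfl
  simp_rw [heq]
  exact (hΦc.sub continuous_const).enorm

/-- The `L^p` difference quotient `h ↦ ‖g(· + h) - g‖_{L^p} / ‖h‖^s` (`eDiffQuotient`) is
continuous at every `h₀ ≠ 0`, for `g ∈ L^p(μ)`, `1 ≤ p < ∞`. [folklore] -/
theorem continuousAt_eDiffQuotient {s : ℝ} {p : ℝ≥0∞} (hp : 1 ≤ p) (hp' : p ≠ ∞) {g : G → F}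
    (hg : MemLp g p μ) {h₀ : G} (hh₀ : h₀ ≠ 0) : ContinuousAt (eDiffQuotient s p g μ) h₀ := by
  have hA := (continuous_eLpNorm_comp_add_sub hp hp' hg).continuousAt (x := h₀)
  have hB : ContinuousAt (fun h : G => ENNReal.ofReal (‖h‖ ^ s)) h₀ :=
    (ENNReal.continuous_ofReal.continuousAt).comp
      ((continuous_norm.continuousAt).rpow_const (Or.inl (norm_ne_zero_iff.2 hh₀)))
  have hB0 : ENNReal.ofReal (‖h₀‖ ^ s) ≠ 0 := (ofReal_norm_rpow_pos s hh₀).ne'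
  exact ENNReal.Tendsto.div hA (Or.inr hB0) hB (Or.inl ENNReal.ofReal_ne_top)

/-- **The Besov sup seminorm is a countable supremum**: for `g ∈ L^p(μ)`, `1 ≤ p < ∞`, and any
sequence `(hₙ)` with dense range in `G`,
`[g]_{B^s_{p,∞}} = sup_{n : hₙ ≠ 0} ‖g(· + hₙ) - g‖_{L^p} / ‖hₙ‖^s` (the difference quotient is
continuous on the open set `{h ≠ 0}`). [folklore] -/
theorem eBesovSupSeminorm_eq_iSup_seq {s : ℝ} {p : ℝ≥0∞} (hp : 1 ≤ p) (hp' : p ≠ ∞) {g : G → F}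
    (hg : MemLp g p μ) {a : ℕ → G} (ha : DenseRange a) :
    eBesovSupSeminorm s p g μ = ⨆ (n : ℕ) (_ : a n ≠ 0), eDiffQuotient s p g μ (a n) := by
  refine le_antisymm ?_ (iSup₂_le fun n hn => eDiffQuotient_le_eBesovSupSeminorm hn)
  refine iSup₂_le fun h₀ hh₀ => le_of_forall_lt fun c hc => ?_
  -- by continuity at `h₀` the quotient exceeds `c` near `h₀`; the sequence enters that region
  have hcont := continuousAt_eDiffQuotient (s := s) hp hp' hg hh₀
  have hev : ∀ᶠ h in 𝓝 h₀, c < eDiffQuotient s p g μ h ∧ h ≠ 0 := by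
    have h1 : ∀ᶠ h in 𝓝 h₀, c < eDiffQuotient s p g μ h := hcont.eventually (lt_mem_nhds hc)
    have h2 : ∀ᶠ h in 𝓝 h₀, h ∈ {h : G | h ≠ 0} := isOpen_ne.mem_nhds hh₀
    filter_upwards [h1, h2] with h hh hh2
    exact ⟨hh, hh2⟩
  obtain ⟨U, hU, hUo, hU₀⟩ := eventually_nhds_iff.1 hev
  obtain ⟨n, hn⟩ := ha.exists_mem_open hUo ⟨h₀, hU₀⟩
  exact lt_of_lt_of_le (hU _ hn).1
    (le_iSup₂ (f := fun n (_ : a n ≠ 0) => eDiffQuotient s p g μ (a n)) n (hU _ hn).2)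

/-! ## Measurability in the parameter -/

omit [LocallyCompactSpace G] [μ.IsAddRightInvariant] [IsFiniteMeasureOnCompacts μ]
  [μ.InnerRegularCompactLTTop] in
/-- For a jointly strongly measurable `U : α × G → F` and a fixed increment `h`, the slice norm
`t ↦ ‖U(t, · + h) - U(t, ·)‖_{L^p(μ)}` is measurable (`0 < p < ∞`; Tonelli, Mathlib's
`Measurable.lintegral_prod_right'`). [folklore] -/
theorem measurable_eLpNorm_slice_comp_add_sub [SFinite μ] {p : ℝ≥0∞} (hp0 : p ≠ 0) (hp' : p ≠ ∞)
    {U : α × G → F} (hU : StronglyMeasurable U) (h : G) :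
    Measurable fun t : α => eLpNorm (fun x => U (t, x + h) - U (t, x)) p μ := by
  have hm : StronglyMeasurable fun q : α × G => U (q.1, q.2 + h) - U q :=
    (hU.comp_measurable (measurable_fst.prodMk (measurable_snd.add_const h))).sub hU
  have hI : Measurable fun t : α => ∫⁻ x, ‖U (t, x + h) - U (t, x)‖ₑ ^ p.toReal ∂μ :=
    (hm.enorm.pow_const _).lintegral_prod_right'
  simp_rw [eLpNorm_eq_lintegral_rpow_enorm_toReal hp0 hp']
  exact hI.pow_const _

omit [LocallyCompactSpace G] [μ.IsAddRightInvariant] [IsFiniteMeasureOnCompacts μ]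
  [μ.InnerRegularCompactLTTop] in
/-- The difference quotient of the slices of a jointly strongly measurable field is measurable
in the parameter, for each fixed increment. [folklore] -/
theorem measurable_eDiffQuotient_slice [SFinite μ] {s : ℝ} {p : ℝ≥0∞} (hp0 : p ≠ 0) (hp' : p ≠ ∞)
    {U : α × G → F} (hU : StronglyMeasurable U) (h : G) :
    Measurable fun t : α => eDiffQuotient s p (fun x => U (t, x)) μ h := by
  unfold eDiffQuotient
  exact (measurable_eLpNorm_slice_comp_add_sub hp0 hp' hU h).div_const _

/-- **Besov sup seminorms of the slices of a jointly measurable field are a.e.-measurable in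
the parameter.** Let `u : α → G → F` be jointly a.e.-strongly measurable on `α × G` (for
`ρ ⊗ μ`) with `u t ∈ L^p(μ)` for `ρ`-a.e. `t`, `1 ≤ p < ∞`. Then
`t ↦ [u t]_{B^s_{p,∞}(μ)}` is `ρ`-a.e.-measurable: on a strongly measurable representative the
seminorm is the countable supremum `eBesovSupSeminorm_eq_iSup_seq` of the measurable
`measurable_eDiffQuotient_slice`, and a.e. slice of `u` agrees a.e. with the representative's
(Mathlib's `Measure.ae_ae_of_ae_prod`), translation being measure preserving. [folklore] -/
theorem aemeasurable_eBesovSupSeminorm_slice [SecondCountableTopology G] [SFinite μ] [SFinite ρ]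
    {s : ℝ} {p : ℝ≥0∞} (hp : 1 ≤ p) (hp' : p ≠ ∞) {u : α → G → F}
    (hm : AEStronglyMeasurable (uncurry u) (ρ.prod μ)) (hu : ∀ᵐ t ∂ρ, MemLp (u t) p μ) :
    AEMeasurable (fun t => eBesovSupSeminorm s p (u t) μ) ρ := by
  have hp0 : p ≠ 0 := (lt_of_lt_of_le zero_lt_one hp).ne'
  set a : ℕ → G := TopologicalSpace.denseSeq G with ha_def
  have ha : DenseRange a := TopologicalSpace.denseRange_denseSeq G
  set U : α × G → F := hm.mk (uncurry u) with hU_def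
  have hU : StronglyMeasurable U := hm.stronglyMeasurable_mk
  have hae : ∀ᵐ t ∂ρ, ∀ᵐ x ∂μ, uncurry u (t, x) = U (t, x) :=
    Measure.ae_ae_of_ae_prod hm.ae_eq_mk
  set Φ : α → ℝ≥0∞ := fun t => ⨆ (n : ℕ) (_ : a n ≠ 0), eDiffQuotient s p (fun x => U (t, x)) μ (a n)
    with hΦ_def
  have hΦ : Measurable Φ :=
    Measurable.iSup fun n => Measurable.iSup_Prop _ (measurable_eDiffQuotient_slice hp0 hp' hU (a n))
  refine ⟨Φ, hΦ, ?_⟩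
  filter_upwards [hae, hu] with t ht htp
  have hslice : u t =ᵐ[μ] fun x => U (t, x) := ht
  have hUp : MemLp (fun x => U (t, x)) p μ := htp.ae_eq hslice
  have hq : ∀ h, eDiffQuotient s p (u t) μ h = eDiffQuotient s p (fun x => U (t, x)) μ h := by
    intro h
    simp only [eDiffQuotient]
    congr 1
    refine eLpNorm_congr_ae ?_
    have h1 : (u t ∘ fun x => x + h) =ᵐ[μ] ((fun x => U (t, x)) ∘ fun x => x + h) :=
      (measurePreserving_add_right μ h).quasiMeasurePreserving.ae_eq_comp hslice
    filter_upwards [hslice, h1] with x hx hx1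
    simp only [Function.comp] at hx1
    rw [hx, hx1]
  calc eBesovSupSeminorm s p (u t) μ = eBesovSupSeminorm s p (fun x => U (t, x)) μ := by
        simp only [eBesovSupSeminorm, hq]
    _ = Φ t := eBesovSupSeminorm_eq_iSup_seq hp hp' hUp ha

/-- **Torus specialisation** (the form used for `L^q_t B^s_{p,∞}(T^d)` classes): for a field
`u : ℝ → T^d → ℝ^d` jointly measurable on `S × T^d` with `u t ∈ L^p` for a.e. `t ∈ S`,
`t ↦ [u t]_{B^s_{p,∞}}` is a.e.-measurable on `S`. [folklore] -/
theorem Torus.aemeasurable_eBesovSupSeminorm_slice {d : Type*} [Fintype d] {E : Type*}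
    [NormedAddCommGroup E] {u : ℝ → UnitAddTorus d → E} {S : Set ℝ} {s : ℝ} {p : ℝ≥0∞}
    (hp : 1 ≤ p) (hp' : p ≠ ∞)
    (hm : AEStronglyMeasurable (uncurry u) ((volume.restrict S).prod volume))
    (hu : ∀ᵐ t ∂(volume.restrict S), MemLp (u t) p volume) :
    AEMeasurable (fun t => eBesovSupSeminorm s p (u t) volume) (volume.restrict S) :=
  Literature.Analysis.FunctionSpaces.aemeasurable_eBesovSupSeminorm_slice hp hp' hm hu

end Literature.Analysis.FunctionSpaces

end
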